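import Literature.NumberTheory.Transcendental.KZLogCalculusProofs
import Literature.NumberTheory.Transcendental.KZCalculusProofs

/-!
# `stub_goodWeight` of skeleton d39c9ad6 (line `spectator-localisation`, crux
stmt-KontsevichZagierPeriods-2837) is a THEOREM — candidate proof for the lead prover

Refuter drefute seat `refuter-drefute-stmt-KontsevichZagierPeriods-2837-g2-0` (gen 2), 2026-08-16.

Statement (verbatim the registered stub signature): for a one-dimensional representation `s` of
non-zero value there are rationals `a < b`, a bounded `ℚ`-semialgebraic weight `w : ℝ → ℝ`
vanishing off `[a, b]`, with `[a, b] ⊆ s.domain` and `w · s.integrand = (b − a)⁻¹` on `[a, b]`.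

Proof.  `S = {x ∈ s.domain | s.integrand x ≠ 0}` is `ℚ`-semialgebraic (graph elimination,
`isSemialgebraic_sep_snoc_mem` + Tarski–Seidenberg); if `interior S = ∅` then `volume S = 0`
(`KZ.volume_eq_zero_of_interior_eq_empty`), so the integrand is a.e. `0` on the domain and the value
is `0`.  Hence `S` contains an open rational interval `G`, on which the integrand is `C^∞` off a
semialgebraic `Z` with empty interior (`IsSemialgebraicFunOn.exists_contDiffOn_holds`); at a point
`q ∈ G \ Z` the integrand is continuous and non-zero, so `|s.integrand| ≥ |s.integrand q| / 2 =: m > 0`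
on a rational interval `[a, b] ∋ q` inside `G`.  The weight is `w = (b − a)⁻¹ / s.integrand` on
`[a, b]` and `0` elsewhere: bounded by `(b − a)⁻¹ / m`, and `ℚ`-semialgebraic by graph elimination.
-/

noncomputable section

namespace DrefuteSpectatorLocalisationG2

open MeasureTheory Set Filter MvPolynomial Metric
open scoped Topology
open Literature.NumberTheory.Transcendental Literature.ModelTheory.ExponentialFields

/-- A vector in `ℝ¹` is the constant function with value its `0`-th coordinate. -/
theorem eq_const_of_fin_one (t : Fin 1 → ℝ) : t = fun _ => t 0 := by
  funext i
  rw [Subsingleton.elim i 0]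

theorem init_eq_const (v : Fin 2 → ℝ) : (Fin.init v : Fin 1 → ℝ) = fun _ => v 0 := by
  funext i
  rw [Subsingleton.elim i 0]
  rfl

/-- The open rational coordinate interval `{a < t 0 < b} ⊆ ℝ¹` is `ℚ`-semialgebraic. -/
theorem isSemialgebraic_iooSet (a b : ℚ) :
    IsSemialgebraic ℚ {t : Fin 1 → ℝ | (a : ℝ) < t 0 ∧ t 0 < (b : ℝ)} := by
  have h1 := isSemialgebraic_setOf_eval_lt (k := ℚ) (R := ℝ) (C a) (X (0 : Fin 1))
  have h2 := isSemialgebraic_setOf_eval_lt (k := ℚ) (R := ℝ) (X (0 : Fin 1)) (C b)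
  simp only [aeval_X, aeval_C, eq_ratCast] at h1 h2
  simpa [setOf_and] using h1.inter h2

/-- The closed rational coordinate interval `{a ≤ t 0 ≤ b} ⊆ ℝ¹` is `ℚ`-semialgebraic. -/
theorem isSemialgebraic_iccSet (a b : ℚ) :
    IsSemialgebraic ℚ {t : Fin 1 → ℝ | (a : ℝ) ≤ t 0 ∧ t 0 ≤ (b : ℝ)} := by
  have h1 := isSemialgebraic_setOf_eval_le (k := ℚ) (R := ℝ) (C a) (X (0 : Fin 1))
  have h2 := isSemialgebraic_setOf_eval_le (k := ℚ) (R := ℝ) (X (0 : Fin 1)) (C b)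
  simp only [aeval_X, aeval_C, eq_ratCast] at h1 h2
  simpa [setOf_and] using h1.inter h2

theorem isOpen_iooSet (a b : ℝ) : IsOpen {t : Fin 1 → ℝ | a < t 0 ∧ t 0 < b} := by
  have : {t : Fin 1 → ℝ | a < t 0 ∧ t 0 < b} = (fun t : Fin 1 → ℝ => t 0) ⁻¹' Ioo a b := by
    ext t; simp
  rw [this]
  exact isOpen_Ioo.preimage (continuous_apply 0)

/-- `{x ∈ D | f x ≠ 0}` is `ℚ`-semialgebraic for a `ℚ`-semialgebraic function `f` on `D`. -/
theorem isSemialgebraic_sep_ne_zero {m : ℕ} {D : Set (Fin m → ℝ)} {f : (Fin m → ℝ) → ℝ}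
    (hf : IsSemialgebraicFunOn ℚ D f) : IsSemialgebraic ℚ {x | x ∈ D ∧ f x ≠ 0} := by
  have hT : IsSemialgebraic ℚ {u : Fin (m + 1) → ℝ | aeval u (X (Fin.last m) : MvPolynomial _ ℚ) ≠ 0} :=
    isSemialgebraic_setOf_eval_ne_zero _
  convert hf.isSemialgebraic_sep_snoc_mem tarski_seidenberg_real_holds hT using 1
  ext x
  simp

/-- **Core of `stub_goodWeight`.** A one-dimensional representation of non-zero value has a closed
rational interval inside its domain on which the integrand is bounded away from `0`. -/
theorem exists_good_interval (s : KZ.IntegralRep 1) (hs : s.value ≠ 0) :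
    ∃ (a b : ℚ) (m : ℝ), a < b ∧ 0 < m ∧
      ∀ t : Fin 1 → ℝ, (a : ℝ) ≤ t 0 → t 0 ≤ (b : ℝ) → t ∈ s.domain ∧ m ≤ |s.integrand t| := by
  set D := s.domain with hD
  set f := s.integrand with hf
  have hDsa : IsSemialgebraic ℚ D := s.isSemialgebraic_domain
  have hfsa : IsSemialgebraicFunOn ℚ D f := s.isSemialgebraicFunOn_integrand
  have hDm : MeasurableSet D := IsSemialgebraic.measurableSet_holds hDsa
  set S := {x | x ∈ D ∧ f x ≠ 0} with hS
  have hSsa : IsSemialgebraic ℚ S := isSemialgebraic_sep_ne_zero hfsa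
  -- `interior S` is non-empty, otherwise the value vanishes
  have hint : (interior S).Nonempty := by
    by_contra hne
    rw [not_nonempty_iff_eq_empty] at hne
    have hvol : volume S = 0 := KZ.volume_eq_zero_of_interior_eq_empty hSsa hne
    have hae : ∀ᵐ x ∂(volume.restrict D), f x = 0 := by
      rw [ae_restrict_iff' hDm, ae_iff]
      convert hvol using 2
      ext x
      simp [hS, Classical.not_imp]
    exact hs (integral_eq_zero_of_ae hae)
  obtain ⟨p, hp⟩ := hint
  obtain ⟨ε, hε, hball⟩ := Metric.mem_nhds_iff.mp (isOpen_interior.mem_nhds hp)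
  have hballS : ball p ε ⊆ S := hball.trans interior_subset
  -- an open rational interval `G` with `p ∈ G ⊆ S`
  obtain ⟨a₀, ha₀l, ha₀r⟩ := exists_rat_btwn (show p 0 - ε < p 0 by linarith)
  obtain ⟨b₀, hb₀l, hb₀r⟩ := exists_rat_btwn (show p 0 < p 0 + ε by linarith)
  set G := {t : Fin 1 → ℝ | (a₀ : ℝ) < t 0 ∧ t 0 < (b₀ : ℝ)} with hG
  have hGball : G ⊆ ball p ε := by
    intro t ht
    rw [mem_ball, dist_pi_lt_iff hε]
    intro i
    rw [Subsingleton.elim i 0, Real.dist_eq, abs_lt]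
    constructor <;> linarith [ht.1, ht.2]
  have hGS : G ⊆ S := hGball.trans hballS
  have hGD : G ⊆ D := fun t ht => (hGS ht).1
  have hGsa : IsSemialgebraic ℚ G := isSemialgebraic_iooSet a₀ b₀
  have hGopen : IsOpen G := isOpen_iooSet _ _
  have hpG : p ∈ G := ⟨ha₀r, hb₀l⟩
  have hfG : IsSemialgebraicFunOn ℚ G f := hfsa.mono hGD hGsa
  obtain ⟨Z, -, -, hZint, hopen, hsmooth⟩ :=
    IsSemialgebraicFunOn.exists_contDiffOn_holds (k := ℚ) hGopen hfG
  -- a point `q ∈ G \ Z`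
  have hGZ : (G \ Z).Nonempty := by
    by_contra hne
    rw [not_nonempty_iff_eq_empty] at hne
    have hsub : G ⊆ Z := fun x hx => by
      by_contra hxZ
      have : x ∈ G \ Z := ⟨hx, hxZ⟩
      rw [hne] at this
      exact this
    have : p ∈ interior Z := interior_mono hsub (by rwa [hGopen.interior_eq])
    rw [hZint] at this
    exact this
  obtain ⟨q, hq⟩ := hGZ
  have hqG : q ∈ G := hq.1
  have hfq : f q ≠ 0 := (hGS hqG).2
  have hcont : ContinuousAt f q :=
    (hsmooth.continuousOn.continuousAt (hopen.mem_nhds hq))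
  set m := |f q| / 2 with hm
  have hm0 : 0 < m := by positivity
  obtain ⟨δ, hδ, hδf⟩ := Metric.continuousAt_iff.mp hcont m hm0
  -- rationals `a < b` with `[a, b] ⊆ G ∩ ball q δ`
  have hlow : max (a₀ : ℝ) (q 0 - δ) < q 0 := max_lt hqG.1 (by linarith)
  have hhigh : q 0 < min (b₀ : ℝ) (q 0 + δ) := lt_min hqG.2 (by linarith)
  obtain ⟨a, hal, har⟩ := exists_rat_btwn hlow
  obtain ⟨b, hbl, hbr⟩ := exists_rat_btwn hhigh
  have hab : a < b := by
    have : (a : ℝ) < b := har.trans hbl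
    exact_mod_cast this
  refine ⟨a, b, m, hab, hm0, fun t hta htb => ?_⟩
  have ha₀a : (a₀ : ℝ) < a := lt_of_le_of_lt (le_max_left _ _) hal
  have hδa : q 0 - δ < a := lt_of_le_of_lt (le_max_right _ _) hal
  have hbb₀ : (b : ℝ) < b₀ := lt_of_lt_of_le hbr (min_le_left _ _)
  have hbδ : (b : ℝ) < q 0 + δ := lt_of_lt_of_le hbr (min_le_right _ _)
  have htG : t ∈ G := ⟨by linarith, by linarith⟩
  have htq : dist t q < δ := by
    rw [dist_pi_lt_iff hδ]
    intro i
    rw [Subsingleton.elim i 0, Real.dist_eq, abs_lt]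
    constructor <;> linarith
  have hft : dist (f t) (f q) < m := hδf htq
  refine ⟨hGD htG, ?_⟩
  rw [Real.dist_eq] at hft
  have h1 : |f q| ≤ |f t| + |f t - f q| := by
    calc |f q| = |f t - (f t - f q)| := by ring_nf
      _ ≤ |f t| + |f t - f q| := abs_sub _ _
  rw [hm] at hft ⊢
  linarith

/-! ### The weight -/

/-- **`stub_goodWeight` holds** (verbatim the registered signature of skeleton d39c9ad6). -/
theorem stub_goodWeight_holds :
    ∀ (s : Literature.NumberTheory.Transcendental.KZ.IntegralRep 1), s.value ≠ 0 → ∃ (a b : ℚ) (w : ℝ → ℝ) (M : ℝ), a < b ∧ Literature.NumberTheory.Transcendental.IsSemialgebraicFunOn ℚ (Set.univ : Set (Fin 1 → ℝ)) (fun t => w (t 0)) ∧ (∀ x : ℝ, |w x| ≤ M) ∧ (∀ t : Fin 1 → ℝ, (a : ℝ) ≤ t 0 → t 0 ≤ (b : ℝ) → t ∈ s.domain ∧ w (t 0) * s.integrand t = ((b - a : ℚ) : ℝ)⁻¹) ∧ (∀ x : ℝ, (x < (a : ℝ) ∨ (b : ℝ) < x) → w x = 0) := by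
  intro s hs
  obtain ⟨a, b, m, hab, hm0, hgood⟩ := exists_good_interval s hs
  classical
  set c : ℚ := (b - a)⁻¹ with hc
  have hcR : ((b - a : ℚ) : ℝ)⁻¹ = (c : ℝ) := by rw [hc]; push_cast; rfl
  -- the weight
  set w : ℝ → ℝ := fun x => if (a : ℝ) ≤ x ∧ x ≤ (b : ℝ) then (c : ℝ) / s.integrand (fun _ => x) else 0
    with hw
  have hw_in : ∀ x : ℝ, (a : ℝ) ≤ x → x ≤ (b : ℝ) → w x = (c : ℝ) / s.integrand (fun _ => x) := by
    intro x h1 h2; rw [hw]; exact if_pos ⟨h1, h2⟩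
  have hw_out : ∀ x : ℝ, (x < (a : ℝ) ∨ (b : ℝ) < x) → w x = 0 := by
    intro x hx; rw [hw]
    refine if_neg ?_
    rintro ⟨h1, h2⟩
    rcases hx with hx | hx <;> linarith
  -- non-vanishing of the integrand on `[a, b]`
  have hne : ∀ t : Fin 1 → ℝ, (a : ℝ) ≤ t 0 → t 0 ≤ (b : ℝ) → s.integrand t ≠ 0 := by
    intro t h1 h2 h0
    have := (hgood t h1 h2).2
    rw [h0, abs_zero] at this
    linarith
  refine ⟨a, b, w, |(c : ℝ)| / m, hab, ?_, ?_, ?_, hw_out⟩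
  · -- semialgebraicity of `t ↦ w (t 0)` on `ℝ¹`: graph = A ∪ B
    rw [isSemialgebraicFunOn_iff]
    set I := {t : Fin 1 → ℝ | (a : ℝ) ≤ t 0 ∧ t 0 ≤ (b : ℝ)} with hI
    have hIsa : IsSemialgebraic ℚ I := isSemialgebraic_iccSet a b
    have hID : I ⊆ s.domain := fun t ht => (hgood t ht.1 ht.2).1
    have hfI : IsSemialgebraicFunOn ℚ I s.integrand := s.isSemialgebraicFunOn_integrand.mono hID hIsa
    have hT : IsSemialgebraic ℚ
        {u : Fin (1 + 2) → ℝ | aeval u (X (1 : Fin 3) * X (2 : Fin 3) - C c : MvPolynomial (Fin 3) ℚ) = 0} :=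
      isSemialgebraic_setOf_eval_eq_zero _
    have hA := hfI.isSemialgebraic_setOf_snoc_mem tarski_seidenberg_real_holds hT
    have hB : IsSemialgebraic ℚ
        {v : Fin 2 → ℝ | (v 0 < (a : ℝ) ∨ (b : ℝ) < v 0) ∧ v 1 = 0} := by
      have h1 := isSemialgebraic_setOf_eval_lt (k := ℚ) (R := ℝ) (X (0 : Fin 2)) (C a)
      have h2 := isSemialgebraic_setOf_eval_lt (k := ℚ) (R := ℝ) (C b) (X (0 : Fin 2))
      have h3 := isSemialgebraic_setOf_eval_eq_zero (k := ℚ) (R := ℝ) (X (1 : Fin 2))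
      simp only [aeval_X, aeval_C, eq_ratCast] at h1 h2 h3
      simpa [setOf_and, setOf_or] using (h1.union h2).inter h3
    convert hA.union hB using 1
    ext v
    have e0 : (Fin.init v : Fin 1 → ℝ) 0 = v 0 := rfl
    have e1 : v (Fin.last 1) = v 1 := rfl
    have einit : (Fin.init v : Fin 1 → ℝ) = fun _ => v 0 := init_eq_const v
    simp only [mem_univ, true_and, mem_setOf_eq, mem_union, map_sub, map_mul, aeval_X, aeval_C,
      eq_ratCast, e1, hI, e0]
    have s1 : (Fin.snoc v (s.integrand (Fin.init v)) : Fin 3 → ℝ) 1 = v 1 := by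
      simp [Fin.snoc]
    have s2 : (Fin.snoc v (s.integrand (Fin.init v)) : Fin 3 → ℝ) 2 = s.integrand (Fin.init v) := by
      simp [Fin.snoc]
    rw [s1, s2, einit]
    by_cases hin : (a : ℝ) ≤ v 0 ∧ v 0 ≤ (b : ℝ)
    · have hF : s.integrand (fun _ => v 0) ≠ 0 := hne (fun _ => v 0) hin.1 hin.2
      rw [hw_in (v 0) hin.1 hin.2]
      constructor
      · intro h
        left
        exact ⟨hin, by rw [h, div_mul_cancel₀ _ hF, sub_self]⟩
      · rintro (⟨-, h⟩ | ⟨h, -⟩)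
        · rw [eq_div_iff hF]; linarith
        · exfalso; rcases h with h | h <;> linarith [hin.1, hin.2]
    · have hout : v 0 < (a : ℝ) ∨ (b : ℝ) < v 0 := by
        rcases not_and_or.mp hin with h | h
        · exact Or.inl (not_le.mp h)
        · exact Or.inr (not_le.mp h)
      rw [hw_out (v 0) hout]
      constructor
      · intro h; right; exact ⟨hout, h⟩
      · rintro (⟨h, -⟩ | ⟨-, h⟩)
        · exact absurd h hin
        · exact h
  · -- the bound
    intro x
    by_cases hin : (a : ℝ) ≤ x ∧ x ≤ (b : ℝ)
    · rw [hw_in x hin.1 hin.2, abs_div]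
      have hmt := (hgood (fun _ => x) hin.1 hin.2).2
      exact div_le_div_of_nonneg_left (abs_nonneg _) hm0 hmt
    · have hout : x < (a : ℝ) ∨ (b : ℝ) < x := by
        rcases not_and_or.mp hin with h | h
        · exact Or.inl (not_le.mp h)
        · exact Or.inr (not_le.mp h)
      rw [hw_out x hout, abs_zero]
      positivity
  · -- the identity on `[a, b]`
    intro t h1 h2
    refine ⟨(hgood t h1 h2).1, ?_⟩
    rw [hw_in (t 0) h1 h2, ← eq_const_of_fin_one t, hcR]
    exact div_mul_cancel₀ _ (hne t h1 h2)

end DrefuteSpectatorLocalisationG2
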